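import Literature.AnabelianGeometry.SemiGraphs.CoveringBranchFrames
import Literature.AnabelianGeometry.SemiGraphs.Commensurability
import Literature.AnabelianGeometry.Anabelioids.FiberFunctorUnique

/-!
# Finite étale coverings of totally estranged / aloof semi-graphs of anabelioids ([SemiAnbd] Def. 2.4 (iv)) — (D7)

Mochizuki, *Semi-graphs of anabelioids*, Publ. RIMS **42** (2006) 221–322, Def. 2.4 (iv) p. 26
("aloof", "estranged"), Def. 2.2 (i) p. 23 (the finite étale covering ATTACHED TO an object of
`B(𝒢)` — a construction) [cite: MochizukiSemiAnbd2006, Def. 2.4(iv) p.26].  abc-iut cell, layer L3,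
DISCHARGE-L3 §G row G30 (D7), finding L4t17-F1 / rulings μ2, π2 (2026-08-25; abc-iut-L4-t17): the
dictionary fact `covering_isTotallyEstranged` is FALSE for twisted branch functors (the 2-cells
`Hom.φB` are data), so it is stated for BRANCH-ALIGNED coverings (`Hom.IsBranchAligned`,
`FiniteEtaleCoveringGlobalDef`); this file proves it in that form:

`covering_isTotallyEstranged_of_isBranchAligned (φ) (A) (hφ : φ.IsFiniteEtaleCoveringOf A)
  (hal : φ.IsBranchAligned) : (𝒢.IsTotallyEstranged → 𝒢′.IsTotallyEstranged) ∧ (𝒢.IsTotallyAloof → 𝒢′.IsTotallyAloof)`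

via ONE parametric transfer `edgeIntersectionCondition_of_isBranchAligned` of the intersection
condition of Def. 2.4 (iv) along `ι := π₁(φ_{v′}^*) : Π_{v′} ↪ Π_v` (injective: finite étale):
`ι(Π_{b′}) ≤ Π_b^{al}` with finite index (`CoveringBranchFrames`); second conjunct by alignment (i)
(`g′ ∉ Π_{b′} ⇒ ι g′ ∉ Π_b^{al}`); first conjunct by `𝒢`'s first conjunct when `φ(b″) ≠ φ(b′)`, and
by the frame change `Π_{b,1}^{al} = t Π_{b,2}^{al} t⁻¹` plus `𝒢`'s second conjunct at
`g := ι(g′) t⁻¹ ∉ Π_b^{al}` (alignment (ii)) when `φ(b″) = φ(b′)`; infinite index / triviality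
descend along the finite-index sandwich.  Neither connectedness nor the global clause is needed.
Nothing here takes a side on [IUTchIII] Cor. 3.12; typed ≠ discharged.
-/

namespace Literature.AnabelianGeometry

open CategoryTheory CategoryTheory.Functor CategoryTheory.PreGaloisCategory
open scoped Pointwise

namespace SemiGraphs

open Literature.AnabelianGeometry.Anabelioids

universe v₁ u₁ u

namespace SemiGraphOfAnabelioids

variable {𝒢 𝒢' : SemiGraphOfAnabelioids.{v₁, u₁, u}}

/-! ### The transfer theorem -/

/-- **Core of (D7).** For a finite étale covering `φ : 𝒢′ → 𝒢` attached to `A` which is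
BRANCH-ALIGNED, and a transferable predicate `P` (one that descends along an injective `ι` through a
finite-index sandwich `ι(B′) ≤ B`, `ι(I′) ≤ J`): the intersection condition of Def. 2.4 (iv) for
`𝒢` at `φ(e′)` implies it for `𝒢′` at `e′`.  Proof: `ι := π₁(φ_{v′}^*)` is injective (finite
étale), `ι(Π_{b′}) ≤ Π_b^{al}` of finite index; second conjunct: `g′ ∉ Π_{b′} ⇒ ι g′ ∉ Π_b^{al}`
(alignment (i)); first conjunct with `φ(b″) ≠ b`: `𝒢`'s first conjunct; with `φ(b″) = b`: frame
change `Π_{b,1}^{al} = t Π_{b,2}^{al} t⁻¹` and `𝒢`'s second conjunct at `g := ι(g′) t⁻¹`, which lies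
outside `Π_b^{al}` by alignment (ii). [cite: MochizukiSemiAnbd2006, Def. 2.4(iv) p.26] -/
theorem edgeIntersectionCondition_of_isBranchAligned
    (P : ∀ {Γ : Type (max u₁ v₁)} [Group Γ], Subgroup Γ → Subgroup Γ → Prop)
    (hP : ∀ {Γ' Γ : Type (max u₁ v₁)} [Group Γ'] [Group Γ] (ι : Γ' →* Γ),
      Function.Injective ι → ∀ {I' B' : Subgroup Γ'} {J B : Subgroup Γ},
        I' ≤ B' → B'.map ι ≤ B → (B'.map ι).relIndex B ≠ 0 → I'.map ι ≤ J → P B J → P B' I')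
    (φ : Hom 𝒢' 𝒢) (A : 𝒢.BObj) (hφ : φ.IsFiniteEtaleCoveringOf A) (hal : φ.IsBranchAligned)
    (e' : 𝒢'.graph.Edge) (h𝒢 : 𝒢.EdgeIntersectionCondition (φ.base.edgeMap e') P) :
    𝒢'.EdgeIntersectionCondition e' P := by
  intro b' hb' v' h' F' _ Fe' _ α'
  -- the vertex: `ι := π₁(φ_{v′}^*)` injective, `F := φ_{v′}^* ⋙ F′` a basepoint of `𝒢_v`
  obtain ⟨SV, hSV, αV, hαV, ⟨eV⟩⟩ := exists_iso_star_comp_φV φ A hφ v'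
  haveI := hSV; haveI := hαV
  haveI : FiberFunctor ((φ.φV v').pullback ⋙ F') :=
    (nonempty_fiberFunctor_of_iso_star_comp_of_isConnected SV αV eV F').some
  set ι := pi1Map (φ.φV v').pullback F' with hιdef
  have hι : Function.Injective ι := isPi1Mono_of_isFiniteEtale ⟨SV, αV, hαV, ⟨eV⟩⟩ _
  -- the edge of `b′`: basepoint `φ_{e′}^* ⋙ F_e′` of `𝒢_e`, finite index
  have hv : 𝒢.graph.abuts (φ.base.branchMap b') = some (φ.base.vertexMap v') :=
    φ.base.abuts_branchMap b' v' h'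
  obtain ⟨S₁, hS₁, αE₁, hαE₁, ⟨eE₁⟩⟩ := exists_iso_star_comp_φE φ A hφ (𝒢'.graph.edgeOf b')
    (𝒢.graph.edgeOf (φ.base.branchMap b')) (φ.base.edgeOf_branchMap b').symm
  haveI := hS₁; haveI := hαE₁
  set R₁ := (φ.φE (𝒢'.graph.edgeOf b') (𝒢.graph.edgeOf (φ.base.branchMap b'))
    (φ.base.edgeOf_branchMap b').symm).pullback with hR₁
  haveI : FiberFunctor (R₁ ⋙ Fe') :=
    (nonempty_fiberFunctor_of_iso_star_comp_of_isConnected S₁ αE₁ eE₁ Fe').some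
  have hfin₁ : (pi1Map R₁ Fe').range.index ≠ 0 := index_range_pi1Map_ne_zero S₁ αE₁ eE₁ Fe'
  -- the subgroups
  set B' := 𝒢'.branchSubgroup F' b' h' Fe' α' with hB'
  set B := φ.alignedBranchSubgroup b' v' h' (φ.base.branchMap b') rfl F' Fe' α' with hB
  have hB'B : B'.map ι ≤ B := map_branchSubgroup_le_aligned φ b' v' h' _ rfl F' Fe' α'
  have hfin : (B'.map ι).relIndex B ≠ 0 :=
    relIndex_map_branchSubgroup_aligned_ne_zero φ b' v' h' _ rfl F' Fe' α' hfin₁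
  have hcomap : B.comap ι ≤ B' := (hal v' F' (φ.base.branchMap b')).1 b' h' rfl Fe' α'
  -- `𝒢`'s condition at `b = φ(b′)` in the aligned frame
  have hedge : 𝒢.graph.edgeOf (φ.base.branchMap b') = φ.base.edgeMap e' := by
    rw [φ.base.edgeOf_branchMap, hb']
  obtain ⟨H1, H2⟩ := h𝒢 (φ.base.branchMap b') hedge (φ.base.vertexMap v') hv
    ((φ.φV v').pullback ⋙ F') (R₁ ⋙ Fe') (φ.alignIso b' v' h' _ rfl F' Fe' α')
  refine ⟨fun b'' h'' Fe'' _ α'' g' hne => ?_, fun g' hg' => ?_⟩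
  · -- FIRST conjunct: another branch `b″ ≠ b′` at `v′`
    set B'' := 𝒢'.branchSubgroup F' b'' h'' Fe'' α'' with hB''
    by_cases hbb : φ.base.branchMap b'' = φ.base.branchMap b'
    · -- `b″` lies over the same `b`: frame change + alignment (ii)
      obtain ⟨S₂, hS₂, αE₂, hαE₂, ⟨eE₂⟩⟩ := exists_iso_star_comp_φE φ A hφ (𝒢'.graph.edgeOf b'')
        (𝒢.graph.edgeOf (φ.base.branchMap b')) (by rw [← hbb]; exact (φ.base.edgeOf_branchMap b'').symm)
      haveI := hS₂; haveI := hαE₂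
      set R₂ := (φ.φE (𝒢'.graph.edgeOf b'') (𝒢.graph.edgeOf (φ.base.branchMap b'))
        (by rw [← hbb]; exact (φ.base.edgeOf_branchMap b'').symm)).pullback with hR₂
      haveI : FiberFunctor (R₂ ⋙ Fe'') :=
        (nonempty_fiberFunctor_of_iso_star_comp_of_isConnected S₂ αE₂ eE₂ Fe'').some
      set B₂ := φ.alignedBranchSubgroup b'' v' h'' (φ.base.branchMap b') hbb F' Fe'' α'' with hB₂
      have hB''B₂ : B''.map ι ≤ B₂ := map_branchSubgroup_le_aligned φ b'' v' h'' _ hbb F' Fe'' α''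
      obtain ⟨θ⟩ := nonempty_iso_of_fiberFunctor (R₂ ⋙ Fe'') (R₁ ⋙ Fe')
      set t : Aut ((φ.φV v').pullback ⋙ F') :=
        transportAut (φ.alignIso b'' v' h'' _ hbb F' Fe'' α'')
          (isoWhiskerLeft (𝒢.pull (φ.base.branchMap b') (φ.base.vertexMap v')
            (φ.base.abuts_branchMap b' v' h')).pullback θ ≪≫
          φ.alignIso b' v' h' _ rfl F' Fe' α') with ht
      have hT : B = ConjAct.toConjAct t • B₂ :=
        branchSubgroup_eq_conjAct_smul_of_iso 𝒢 _ _ _ θ _ _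
      set g : Aut ((φ.φV v').pullback ⋙ F') := ι g' * t⁻¹ with hg
      by_cases hgB : g ∈ B
      · exfalso
        refine (hal v' F' (φ.base.branchMap b')).2 b' b'' h' h'' rfl hbb (Ne.symm hne)
          Fe' α' Fe'' α'' θ g⁻¹ (inv_mem hgB) g' ?_
        rw [hg, mul_inv_rev, inv_inv, inv_mul_cancel_right]
        exact rfl
      · have hJ := H2 g hgB
        refine hP ι hι inf_le_left hB'B hfin ?_ hJ
        calc (B' ⊓ ConjAct.toConjAct g' • B'').map ι
            ≤ B'.map ι ⊓ (ConjAct.toConjAct g' • B'').map ι := Subgroup.map_inf_le _ _ _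
          _ = B'.map ι ⊓ ConjAct.toConjAct (ι g') • B''.map ι := by rw [map_conjAct_smul]
          _ ≤ B ⊓ ConjAct.toConjAct (ι g') • B₂ :=
              inf_le_inf hB'B (Subgroup.pointwise_smul_le_pointwise_smul_iff.mpr hB''B₂)
          _ = B ⊓ ConjAct.toConjAct g • B := by
              rw [hT, smul_smul, ← map_mul, hg, inv_mul_cancel_right]
    · -- `b″` lies over a different branch `b̄ ≠ b` at `v`: `𝒢`'s first conjunct
      obtain ⟨S₂, hS₂, αE₂, hαE₂, ⟨eE₂⟩⟩ := exists_iso_star_comp_φE φ A hφ (𝒢'.graph.edgeOf b'')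
        (𝒢.graph.edgeOf (φ.base.branchMap b'')) (φ.base.edgeOf_branchMap b'').symm
      haveI := hS₂; haveI := hαE₂
      set R₂ := (φ.φE (𝒢'.graph.edgeOf b'') (𝒢.graph.edgeOf (φ.base.branchMap b''))
        (φ.base.edgeOf_branchMap b'').symm).pullback with hR₂
      haveI : FiberFunctor (R₂ ⋙ Fe'') :=
        (nonempty_fiberFunctor_of_iso_star_comp_of_isConnected S₂ αE₂ eE₂ Fe'').some
      set B₂ := φ.alignedBranchSubgroup b'' v' h'' (φ.base.branchMap b'') rfl F' Fe'' α'' with hB₂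
      have hB''B₂ : B''.map ι ≤ B₂ := map_branchSubgroup_le_aligned φ b'' v' h'' _ rfl F' Fe'' α''
      have hJ := H1 (φ.base.branchMap b'') (φ.base.abuts_branchMap b'' v' h'') (R₂ ⋙ Fe'')
        (φ.alignIso b'' v' h'' _ rfl F' Fe'' α'') (ι g') hbb
      refine hP ι hι inf_le_left hB'B hfin ?_ hJ
      calc (B' ⊓ ConjAct.toConjAct g' • B'').map ι
          ≤ B'.map ι ⊓ (ConjAct.toConjAct g' • B'').map ι := Subgroup.map_inf_le _ _ _
        _ = B'.map ι ⊓ ConjAct.toConjAct (ι g') • B''.map ι := by rw [map_conjAct_smul]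
        _ ≤ B ⊓ ConjAct.toConjAct (ι g') • B₂ :=
            inf_le_inf hB'B (Subgroup.pointwise_smul_le_pointwise_smul_iff.mpr hB''B₂)
  · -- SECOND conjunct: `g′ ∉ Π_{b′}` ⇒ `ι g′ ∉ Π_b^{al}` by alignment (i)
    have hg : ι g' ∉ B := fun h => hg' (hcomap (Subgroup.mem_comap.mpr h))
    have hJ := H2 (ι g') hg
    refine hP ι hι inf_le_left hB'B hfin ?_ hJ
    calc (B' ⊓ ConjAct.toConjAct g' • B').map ι
        ≤ B'.map ι ⊓ (ConjAct.toConjAct g' • B').map ι := Subgroup.map_inf_le _ _ _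
      _ = B'.map ι ⊓ ConjAct.toConjAct (ι g') • B'.map ι := by rw [map_conjAct_smul]
      _ ≤ B ⊓ ConjAct.toConjAct (ι g') • B :=
          inf_le_inf hB'B (Subgroup.pointwise_smul_le_pointwise_smul_iff.mpr hB'B)

/-- **(D7, aloof half) for one edge.** A branch-aligned finite étale covering of `𝒢` is aloof at
`e′` if `𝒢` is aloof at `φ(e′)`. [cite: MochizukiSemiAnbd2006, Def. 2.4(iv) p.26] -/
theorem isAloof_of_isBranchAligned (φ : Hom 𝒢' 𝒢) (A : 𝒢.BObj)
    (hφ : φ.IsFiniteEtaleCoveringOf A) (hal : φ.IsBranchAligned) (e' : 𝒢'.graph.Edge)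
    (h : 𝒢.IsAloof (φ.base.edgeMap e')) : 𝒢'.IsAloof e' :=
  edgeIntersectionCondition_of_isBranchAligned _
    (fun ι hι _ _ _ _ hI hB hfin hJ hJB => relIndex_eq_zero_of_map_le ι hι hI hB hfin hJ hJB)
    φ A hφ hal e' h

/-- **(D7, estranged half) for one edge.** A branch-aligned finite étale covering of `𝒢` is
estranged at `e′` if `𝒢` is estranged at `φ(e′)`. [cite: MochizukiSemiAnbd2006, Def. 2.4(iv) p.26] -/
theorem isEstranged_of_isBranchAligned (φ : Hom 𝒢' 𝒢) (A : 𝒢.BObj)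
    (hφ : φ.IsFiniteEtaleCoveringOf A) (hal : φ.IsBranchAligned) (e' : 𝒢'.graph.Edge)
    (h : 𝒢.IsEstranged (φ.base.edgeMap e')) : 𝒢'.IsEstranged e' :=
  edgeIntersectionCondition_of_isBranchAligned _
    (fun ι hι _ _ _ _ hI hB hfin hJ hJB =>
      ⟨relIndex_eq_zero_of_map_le ι hι hI hB hfin hJ hJB.1,
        eq_bot_of_map_le ι hι hJ hJB.2⟩)
    φ A hφ hal e' h

/-- **(D7) in the shape of the dictionary (v3, ruling μ2):** a branch-aligned finite étale covering
of a totally estranged (resp. totally aloof) semi-graph of anabelioids is totally estranged (resp.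
totally aloof) — connectedness and the global clause are not even needed.
[cite: MochizukiSemiAnbd2006, Def. 2.4(iv) p.26] -/
theorem covering_isTotallyEstranged_of_isBranchAligned (φ : Hom 𝒢' 𝒢) (A : 𝒢.BObj)
    (hφ : φ.IsFiniteEtaleCoveringOf A) (hal : φ.IsBranchAligned) :
    (𝒢.IsTotallyEstranged → 𝒢'.IsTotallyEstranged) ∧ (𝒢.IsTotallyAloof → 𝒢'.IsTotallyAloof) :=
  ⟨fun h => ⟨fun e' => isEstranged_of_isBranchAligned φ A hφ hal e' (h.isEstranged _)⟩,
    fun h => ⟨fun e' => isAloof_of_isBranchAligned φ A hφ hal e' (h.isAloof _)⟩⟩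

end SemiGraphOfAnabelioids

end SemiGraphs

end Literature.AnabelianGeometry
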